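import Mathlib
import HarnessLib
import Literature.Computability.AlgebraicComplexity.PatternExpressions
import Literature.Combinatorics.SimpleGraph.TreeDecomposition
import Literature.Combinatorics.SimpleGraph.TreeDecompositionPetals
import Literature.Combinatorics.SimpleGraph.TreewidthBrambleLowerBound
import Literature.ModelTheory.FiniteModelTheory.CkEquivHomCount
import Summits.ValiantsHypothesis.ValiantsHypothesis.Theorems.MonotoneRestorationOrbitRestorationLinearVolumeQPHomPolyBasics
import Summits.ValiantsHypothesis.ValiantsHypothesis.Theorems.MonotoneRestorationOrbitRestorationQPColumnVandermondesNarrowSpan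

/-!
# The narrow span is an algebra: `Algebra.adjoin = Submodule.span` for bounded-treewidth homomorphism polynomials

Route MonotoneRestoration, crux `OrbitRestorationQP` (stmt-ValiantsHypothesis-18293), SPAN currency (K1
`NarrowExpansionVP`, `PerNotNarrow.qpOrbit_of_mem_narrowSpan`, `HomPolyClose`).  Helper (`--supports`), def-free.

The span-currency statements of the route quantify over the `ℂ`-SPAN of the homomorphism polynomials
`hom_{F,n}` of bipartite patterns `F` of treewidth `≤ w` (any number of vertices), while constructions
(Newton identities, products of generators — e.g. `ColumnVandermondesNarrow.prod_colVandermonde_mem_adjoin_homPoly_tw_two`)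
naturally land in the generated ALGEBRA.  The two agree, because disjoint unions of patterns multiply
(`HomPolyBasics.homPoly_disjointUnion`) and do not raise treewidth.  The missing graph-theoretic input — flagged
as "not claimed in the kernel" in `…LinearWidthFiniteDetermined.lean` — is proved here:

* `treewidth_sum_le` — **the treewidth of a disjoint sum of graphs is at most the larger of the two treewidths**
  (join optimal tree decompositions of the parts by one tree edge: `Dvorak2010.Join.treeDecomposition`);
* `treewidth_patternGraph_map_equiv_le` — relabelling the vertices of a pattern does not raise the treewidth
  of its pattern graph; `treewidth_patternGraph_disjointUnion_le` — the pattern graph of a disjoint union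
  embeds in the sum of the two pattern graphs;
* `exists_homPoly_mul_eq` — the product of two narrow generators is a narrow generator (same `w`);
* `homPoly_empty_eq_one` — `1` is a narrow generator;
* **`narrowSpan_mul_mem`, `adjoin_narrow_le_span`, `mem_narrowSpan_of_mem_adjoin`** — the span is closed under
  products and contains the generated algebra;
* **`prod_colVandermonde_mem_narrowSpan_two`** — consequently the product of the column Vandermondes at an
  even level lies in the SPAN of the treewidth-`≤ 2` homomorphism polynomials, the currency of
  `PerNotNarrow.qpOrbit_of_mem_narrowSpan` (with `2 ≤ (log₂ n + c)^c` for `c ≥ 2`).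

Honest label: infrastructure for the span-currency lane of A_∞ / K1; no stub is closed; VP ≠ VNP untouched.
-/

noncomputable section

-- `Summit.ValiantsHypothesis.ValiantsHypothesis.…` is the tree's single-conjunct layout (Sub = Summit).
set_option linter.dupNamespace false

namespace Summit.ValiantsHypothesis.ValiantsHypothesis.Theorems

namespace NarrowSpanAlgebra

open MvPolynomial Finset
open Literature.Computability.AlgebraicComplexity (homPoly)
open Literature.Combinatorics.SimpleGraph (treewidth TreeDecomposition exists_width_eq_treewidth
  treewidth_le_of_hom_injective treewidth_le_card_sub_one)
open Literature.ModelTheory.FiniteModelTheory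

universe u

/-! ### Treewidth of a disjoint sum of graphs -/

/-- **The treewidth of a disjoint sum is at most the maximum of the treewidths**: join optimal tree
decompositions of the two parts by a single tree edge (bags pushed into the sum type).
[cite: Diestel2010, §12.3 (tree-decompositions; folklore corollary)] -/
theorem treewidth_sum_le {V W : Type u} [Fintype V] [Fintype W] (G : SimpleGraph V) (H : SimpleGraph W) :
    treewidth (G ⊕g H) ≤ max (treewidth G) (treewidth H) := by
  obtain ⟨k₁, D₁, hD₁⟩ := exists_width_eq_treewidth G
  obtain ⟨k₂, D₂, hD₂⟩ := exists_width_eq_treewidth H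
  obtain ⟨r₁⟩ := D₁.isTree.1.nonempty
  obtain ⟨r₂⟩ := D₂.isTree.1.nonempty
  set b₁ : Fin k₁ → Finset (V ⊕ W) := fun t => (D₁.bag t).map Function.Embedding.inl with hb₁
  set b₂ : Fin k₂ → Finset (V ⊕ W) := fun t => (D₂.bag t).map Function.Embedding.inr with hb₂
  have hset₁ : ∀ u : V, {t | (Sum.inl u : V ⊕ W) ∈ b₁ t} = {t | u ∈ D₁.bag t} := by
    intro u; ext t; simp [hb₁]
  have hset₂ : ∀ u : W, {t | (Sum.inr u : V ⊕ W) ∈ b₂ t} = {t | u ∈ D₂.bag t} := by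
    intro u; ext t; simp [hb₂]
  have hyp : Dvorak2010.Join.Hyp (G ⊕g H) D₁.tree D₂.tree b₁ b₂ r₁ r₂ :=
    { isTree₁ := D₁.isTree
      isTree₂ := D₂.isTree
      cover := by
        rintro (u | u) (v | v) huv
        · obtain ⟨t, hu, hv⟩ := D₁.exists_mem_bag_of_adj ((SimpleGraph.sum_adj_inl).1 huv)
          exact Or.inl ⟨t, by simpa [hb₁] using hu, by simpa [hb₁] using hv⟩
        · exact absurd huv (SimpleGraph.not_adj_sum_inl_inr u v)
        · exact absurd huv.symm (SimpleGraph.not_adj_sum_inl_inr v u)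
        · obtain ⟨t, hu, hv⟩ := D₂.exists_mem_bag_of_adj ((SimpleGraph.sum_adj_inr).1 huv)
          exact Or.inr ⟨t, by simpa [hb₂] using hu, by simpa [hb₂] using hv⟩
      mem := by
        rintro (x | x)
        · obtain ⟨t, ht⟩ := D₁.exists_mem_bag x
          exact Or.inl ⟨t, by simpa [hb₁] using ht⟩
        · obtain ⟨t, ht⟩ := D₂.exists_mem_bag x
          exact Or.inr ⟨t, by simpa [hb₂] using ht⟩
      linked₁ := by
        rintro (x | x) a b ha hb
        · have ha' : x ∈ D₁.bag a := by simpa [hb₁] using ha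
          have hb' : x ∈ D₁.bag b := by simpa [hb₁] using hb
          rw [hset₁]
          exact D₁.linked x ha' hb'
        · simp [hb₁] at ha
      linked₂ := by
        rintro (x | x) a b ha hb
        · simp [hb₂] at ha
        · have ha' : x ∈ D₂.bag a := by simpa [hb₂] using ha
          have hb' : x ∈ D₂.bag b := by simpa [hb₂] using hb
          rw [hset₂]
          exact D₂.linked x ha' hb'
      bridge := by
        rintro (x | x) a b ha hb
        · simp [hb₂] at hb
        · simp [hb₁] at ha }
  have hlt := TreeDecomposition.treewidth_lt_of_forall_card_le (Dvorak2010.Join.treeDecomposition hyp)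
    (k := max (treewidth G) (treewidth H) + 1) (by omega) (by
      rintro (t | t)
      · simp only [Dvorak2010.Join.treeDecomposition_bag, Sum.elim_inl, hb₁, Finset.card_map]
        have := D₁.card_bag_le_width_add_one t
        rw [hD₁] at this
        omega
      · simp only [Dvorak2010.Join.treeDecomposition_bag, Sum.elim_inr, hb₂, Finset.card_map]
        have := D₂.card_bag_le_width_add_one t
        rw [hD₂] at this
        omega)
  omega

/-! ### Pattern graphs: relabelling and disjoint unions -/

/-- Relabelling the row- and column-vertices of a pattern along equivalences does not raise the treewidth of
its pattern graph (the inverse relabelling is an injective graph homomorphism). [folklore] -/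
theorem treewidth_patternGraph_map_equiv_le {A B A' B' : Type u} [Fintype A] [Fintype B] [Fintype A']
    [Fintype B'] [DecidableEq A] [DecidableEq B] (E : Multiset (A × B)) (ea : A ≃ A') (eb : B ≃ B') :
    treewidth (SimpleGraph.fromRel fun u v : A' ⊕ B' =>
        ∃ e ∈ E.map (fun e => (ea e.1, eb e.2)), u = Sum.inl e.1 ∧ v = Sum.inr e.2) ≤
      treewidth (SimpleGraph.fromRel fun u v : A ⊕ B => ∃ e ∈ E, u = Sum.inl e.1 ∧ v = Sum.inr e.2) := by
  classical
  refine treewidth_le_of_hom_injective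
    { toFun := Sum.map ea.symm eb.symm
      map_rel' := ?_ } ?_
  · intro u v huv
    rw [SimpleGraph.fromRel_adj] at huv ⊢
    obtain ⟨hne, h⟩ := huv
    refine ⟨fun h' => hne ((Equiv.sumCongr ea.symm eb.symm).injective h'), ?_⟩
    rcases h with ⟨e', he', rfl, rfl⟩ | ⟨e', he', rfl, rfl⟩
    · obtain ⟨e, he, rfl⟩ := Multiset.mem_map.1 he'
      exact Or.inl ⟨e, he, by simp, by simp⟩
    · obtain ⟨e, he, rfl⟩ := Multiset.mem_map.1 he'
      exact Or.inr ⟨e, he, by simp, by simp⟩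
  · exact (Equiv.sumCongr ea.symm eb.symm).injective

/-- The pattern graph of a DISJOINT UNION of two patterns (on the sum types) embeds in the disjoint sum of the
two pattern graphs, so its treewidth is at most the larger one. [folklore] -/
theorem treewidth_patternGraph_disjointUnion_le {A₁ B₁ A₂ B₂ : Type u} [Fintype A₁] [Fintype B₁]
    [Fintype A₂] [Fintype B₂] [DecidableEq A₁] [DecidableEq B₁] [DecidableEq A₂] [DecidableEq B₂]
    (E₁ : Multiset (A₁ × B₁)) (E₂ : Multiset (A₂ × B₂)) :
    treewidth (SimpleGraph.fromRel fun u v : (A₁ ⊕ A₂) ⊕ (B₁ ⊕ B₂) =>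
        ∃ e ∈ ((E₁.map fun e => ((Sum.inl e.1 : A₁ ⊕ A₂), (Sum.inl e.2 : B₁ ⊕ B₂))) +
          E₂.map fun e => ((Sum.inr e.1 : A₁ ⊕ A₂), (Sum.inr e.2 : B₁ ⊕ B₂))),
          u = Sum.inl e.1 ∧ v = Sum.inr e.2) ≤
      max (treewidth (SimpleGraph.fromRel fun u v : A₁ ⊕ B₁ => ∃ e ∈ E₁, u = Sum.inl e.1 ∧ v = Sum.inr e.2))
        (treewidth (SimpleGraph.fromRel fun u v : A₂ ⊕ B₂ => ∃ e ∈ E₂, u = Sum.inl e.1 ∧ v = Sum.inr e.2)) := by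
  classical
  refine le_trans (treewidth_le_of_hom_injective
    { toFun := Equiv.sumSumSumComm A₁ A₂ B₁ B₂
      map_rel' := ?_ } (Equiv.sumSumSumComm A₁ A₂ B₁ B₂).injective) (treewidth_sum_le _ _)
  intro u v huv
  rw [SimpleGraph.fromRel_adj] at huv
  obtain ⟨hne, h⟩ := huv
  rcases h with ⟨e, he, rfl, rfl⟩ | ⟨e, he, rfl, rfl⟩
  · rcases Multiset.mem_add.1 he with he | he
    · obtain ⟨e₁, he₁, rfl⟩ := Multiset.mem_map.1 he
      show (SimpleGraph.fromRel _ ⊕g SimpleGraph.fromRel _).Adj _ _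
      simp [Equiv.sumSumSumComm, SimpleGraph.fromRel_adj, he₁]
    · obtain ⟨e₂, he₂, rfl⟩ := Multiset.mem_map.1 he
      show (SimpleGraph.fromRel _ ⊕g SimpleGraph.fromRel _).Adj _ _
      simp [Equiv.sumSumSumComm, SimpleGraph.fromRel_adj, he₂]
  · rcases Multiset.mem_add.1 he with he | he
    · obtain ⟨e₁, he₁, rfl⟩ := Multiset.mem_map.1 he
      show (SimpleGraph.fromRel _ ⊕g SimpleGraph.fromRel _).Adj _ _
      simp [Equiv.sumSumSumComm, SimpleGraph.fromRel_adj, he₁]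
    · obtain ⟨e₂, he₂, rfl⟩ := Multiset.mem_map.1 he
      show (SimpleGraph.fromRel _ ⊕g SimpleGraph.fromRel _).Adj _ _
      simp [Equiv.sumSumSumComm, SimpleGraph.fromRel_adj, he₂]

/-! ### Products of narrow generators are narrow generators -/

/-- **The product of two narrow generators is a narrow generator (same treewidth bound)**: disjoint union of
the patterns, relabelled to `Fin (a₁ + a₂) × Fin (b₁ + b₂)`. [cite: DwivediPagoSeppelt2026, eq. (1)] -/
theorem exists_homPoly_mul_eq (n w : ℕ) {a₁ b₁ a₂ b₂ : ℕ} (E₁ : Multiset (Fin a₁ × Fin b₁))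
    (E₂ : Multiset (Fin a₂ × Fin b₂))
    (h₁ : treewidth (SimpleGraph.fromRel fun u v : Fin a₁ ⊕ Fin b₁ =>
      ∃ e ∈ E₁, u = Sum.inl e.1 ∧ v = Sum.inr e.2) ≤ w)
    (h₂ : treewidth (SimpleGraph.fromRel fun u v : Fin a₂ ⊕ Fin b₂ =>
      ∃ e ∈ E₂, u = Sum.inl e.1 ∧ v = Sum.inr e.2) ≤ w) :
    ∃ E : Multiset (Fin (a₁ + a₂) × Fin (b₁ + b₂)),
      treewidth (SimpleGraph.fromRel fun u v : Fin (a₁ + a₂) ⊕ Fin (b₁ + b₂) =>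
        ∃ e ∈ E, u = Sum.inl e.1 ∧ v = Sum.inr e.2) ≤ w ∧
      homPoly E n ℂ = homPoly E₁ n ℂ * homPoly E₂ n ℂ := by
  set E₀ : Multiset ((Fin a₁ ⊕ Fin a₂) × (Fin b₁ ⊕ Fin b₂)) :=
    (E₁.map fun e => ((Sum.inl e.1 : Fin a₁ ⊕ Fin a₂), (Sum.inl e.2 : Fin b₁ ⊕ Fin b₂))) +
      E₂.map fun e => ((Sum.inr e.1 : Fin a₁ ⊕ Fin a₂), (Sum.inr e.2 : Fin b₁ ⊕ Fin b₂)) with hE₀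
  refine ⟨E₀.map fun e => (finSumFinEquiv e.1, finSumFinEquiv e.2), ?_, ?_⟩
  · refine (treewidth_patternGraph_map_equiv_le E₀ finSumFinEquiv finSumFinEquiv).trans ?_
    rw [hE₀]
    exact (treewidth_patternGraph_disjointUnion_le E₁ E₂).trans (max_le h₁ h₂)
  · rw [HomPolyBasics.homPoly_map_equiv, hE₀, HomPolyBasics.homPoly_disjointUnion]

/-- **`1` is a narrow generator**: the homomorphism polynomial of the empty pattern on no vertices is `1`, and
its pattern graph has treewidth `0`. [folklore] -/
theorem homPoly_empty_eq_one (n : ℕ) : homPoly (0 : Multiset (Fin 0 × Fin 0)) n ℂ = 1 := by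
  simp [homPoly]

/-- The pattern graph of the empty pattern on no vertices has treewidth `0`. [folklore] -/
theorem treewidth_patternGraph_empty :
    treewidth (SimpleGraph.fromRel fun u v : Fin 0 ⊕ Fin 0 =>
      ∃ e ∈ (0 : Multiset (Fin 0 × Fin 0)), u = Sum.inl e.1 ∧ v = Sum.inr e.2) = 0 := by
  have := treewidth_le_card_sub_one (SimpleGraph.fromRel fun u v : Fin 0 ⊕ Fin 0 =>
      ∃ e ∈ (0 : Multiset (Fin 0 × Fin 0)), u = Sum.inl e.1 ∧ v = Sum.inr e.2)
  simpa using this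

/-! ### The narrow span is a subalgebra -/

/-- **The narrow span is closed under products.** [folklore] -/
theorem narrowSpan_mul_mem (n w : ℕ) {x y : MvPolynomial (Fin n × Fin n) ℂ}
    (hx : x ∈ Submodule.span ℂ {p : MvPolynomial (Fin n × Fin n) ℂ |
        ∃ (a b : ℕ) (E : Multiset (Fin a × Fin b)),
          treewidth (SimpleGraph.fromRel fun u v : Fin a ⊕ Fin b =>
            ∃ e ∈ E, u = Sum.inl e.1 ∧ v = Sum.inr e.2) ≤ w ∧ p = homPoly E n ℂ})
    (hy : y ∈ Submodule.span ℂ {p : MvPolynomial (Fin n × Fin n) ℂ |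
        ∃ (a b : ℕ) (E : Multiset (Fin a × Fin b)),
          treewidth (SimpleGraph.fromRel fun u v : Fin a ⊕ Fin b =>
            ∃ e ∈ E, u = Sum.inl e.1 ∧ v = Sum.inr e.2) ≤ w ∧ p = homPoly E n ℂ}) :
    x * y ∈ Submodule.span ℂ {p : MvPolynomial (Fin n × Fin n) ℂ |
        ∃ (a b : ℕ) (E : Multiset (Fin a × Fin b)),
          treewidth (SimpleGraph.fromRel fun u v : Fin a ⊕ Fin b =>
            ∃ e ∈ E, u = Sum.inl e.1 ∧ v = Sum.inr e.2) ≤ w ∧ p = homPoly E n ℂ} := by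
  have h := Submodule.mul_mem_mul hx hy
  rw [Submodule.span_mul_span] at h
  refine Submodule.span_le.2 ?_ h
  rintro _ ⟨p, ⟨a₁, b₁, E₁, h₁, rfl⟩, q, ⟨a₂, b₂, E₂, h₂, rfl⟩, rfl⟩
  obtain ⟨E, hE, hEq⟩ := exists_homPoly_mul_eq n w E₁ E₂ h₁ h₂
  exact Submodule.subset_span ⟨a₁ + a₂, b₁ + b₂, E, hE, hEq.symm⟩

/-- **The generated algebra is contained in the span** (so they coincide as sets). [folklore] -/
theorem adjoin_narrow_le_span (n w : ℕ) :
    (Algebra.adjoin ℂ {p : MvPolynomial (Fin n × Fin n) ℂ |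
        ∃ (a b : ℕ) (E : Multiset (Fin a × Fin b)),
          treewidth (SimpleGraph.fromRel fun u v : Fin a ⊕ Fin b =>
            ∃ e ∈ E, u = Sum.inl e.1 ∧ v = Sum.inr e.2) ≤ w ∧ p = homPoly E n ℂ}).toSubmodule ≤
      Submodule.span ℂ {p : MvPolynomial (Fin n × Fin n) ℂ |
        ∃ (a b : ℕ) (E : Multiset (Fin a × Fin b)),
          treewidth (SimpleGraph.fromRel fun u v : Fin a ⊕ Fin b =>
            ∃ e ∈ E, u = Sum.inl e.1 ∧ v = Sum.inr e.2) ≤ w ∧ p = homPoly E n ℂ} := by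
  rw [Algebra.adjoin_eq_span]
  refine Submodule.span_le.2 fun x hx => ?_
  refine Submonoid.closure_induction (fun y hy => Submodule.subset_span hy) ?_ ?_ hx
  · exact Submodule.subset_span ⟨0, 0, 0, by rw [treewidth_patternGraph_empty]; exact Nat.zero_le _,
      (homPoly_empty_eq_one n).symm⟩
  · intro y z _ _ hy hz
    exact narrowSpan_mul_mem n w hy hz

/-- Membership form: an element of the generated algebra lies in the narrow span. [folklore] -/
theorem mem_narrowSpan_of_mem_adjoin (n w : ℕ) {x : MvPolynomial (Fin n × Fin n) ℂ}
    (hx : x ∈ Algebra.adjoin ℂ {p : MvPolynomial (Fin n × Fin n) ℂ |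
        ∃ (a b : ℕ) (E : Multiset (Fin a × Fin b)),
          treewidth (SimpleGraph.fromRel fun u v : Fin a ⊕ Fin b =>
            ∃ e ∈ E, u = Sum.inl e.1 ∧ v = Sum.inr e.2) ≤ w ∧ p = homPoly E n ℂ}) :
    x ∈ Submodule.span ℂ {p : MvPolynomial (Fin n × Fin n) ℂ |
        ∃ (a b : ℕ) (E : Multiset (Fin a × Fin b)),
          treewidth (SimpleGraph.fromRel fun u v : Fin a ⊕ Fin b =>
            ∃ e ∈ E, u = Sum.inl e.1 ∧ v = Sum.inr e.2) ≤ w ∧ p = homPoly E n ℂ} :=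
  adjoin_narrow_le_span n w (show x ∈ Subalgebra.toSubmodule _ from hx)

/-! ### The column Vandermondes in SPAN currency -/

/-- **The product of the column Vandermondes at an even level lies in the SPAN of the homomorphism polynomials
of bipartite patterns of treewidth `≤ 2`** — the currency of `PerNotNarrow.qpOrbit_of_mem_narrowSpan`.
[cite: DwivediPagoSeppelt2026, eq. (1) and §8] -/
theorem prod_colVandermonde_mem_narrowSpan_two (m : ℕ) :
    (∏ q : Fin (2 * m), ∏ i : Fin (2 * m), ∏ i' ∈ Ioi i,
        ((X (i', q) : MvPolynomial (Fin (2 * m) × Fin (2 * m)) ℂ) - X (i, q))) ∈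
      Submodule.span ℂ {p : MvPolynomial (Fin (2 * m) × Fin (2 * m)) ℂ |
        ∃ (a b : ℕ) (E : Multiset (Fin a × Fin b)),
          treewidth (SimpleGraph.fromRel fun u v : Fin a ⊕ Fin b =>
            ∃ e ∈ E, u = Sum.inl e.1 ∧ v = Sum.inr e.2) ≤ 2 ∧ p = homPoly E (2 * m) ℂ} :=
  mem_narrowSpan_of_mem_adjoin (2 * m) 2 (ColumnVandermondesNarrow.prod_prod_sub_mem_adjoin_homPoly_tw_two m)

end NarrowSpanAlgebra

end Summit.ValiantsHypothesis.ValiantsHypothesis.Theorems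

end
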